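import Summits.ABC.IUTFork.Cor312Ind3IteratesVacuity
import HarnessLib

/-!
# [IUTchIII] Thm 3.11 (ii) (Ind3), honest model: the BOUNDARY of the vacuous range (abc-iut cell, wave-5 seat
# abc-iut-w5-d172, folding two lemmas offered by abc-iut-w5-d230's independent replication; record-only, D-0012)

S. Mochizuki, *Inter-universal Teichmüller theory III*, kurims manuscript (May 2020), Prop. 3.5 (ii) (a)(b)
pp. 104–105, Rmk. 1.1.1 (i) p. 28 [claim: Mochizuki2012, status: disputed].

`Cor312Ind3IteratesVacuity` (p414009) proved, for abc-iut-w4-d029's honest log-link iterate images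
(`Cor312Ind3RealIterates`, p412330): nonarchimedean depth `≥ 2` images are EMPTY at places with
`e(v|p_v) ≤ p_v − 1` for the analytic logarithms, archimedean depth `≥ 3` images are EMPTY everywhere.  This
PROOF-ONLY companion records the exact boundary of that vacuous range:

* **real places die one step earlier**: `Real.archIterImage_add_two_eq_empty_of_isReal` — at a REAL place the
  depth-`≥ 2` images are already empty (a depth-`≥ 1` element embeds into `iℝ ∩ ℝ = {0}`, which holds no
  norm-one element); census `Real.archIterImage_eq_empty_iff_of_isReal : archIterImage w m = ∅ ↔ 2 ≤ m`;
* **complex places: the threshold `3` is sharp**: `Real.archIterImage_two_nonempty_of_isComplex` (abc-iut-w5-d230's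
  lemma, folded here at their offer: `log i = iπ/2` with `i = log(exp i)` in the first image, Mathlib
  `surjective_extensionEmbedding_of_isComplex`); census
  `Real.archIterImage_eq_empty_iff_of_isComplex : archIterImage w m = ∅ ↔ 3 ≤ m`;
* **nonarchimedean binder-level criterion** (abc-iut-w5-d230's formulation, folded): for ANY family `logv`,
  `Real.nonarchIterImage_add_two_eq_empty_of_forall_ne` — if no `log_v u` is (the image of) a unit, the
  depth-`≥ 2` images are empty — with the norm form `…_of_norm_lt_one` (`‖log_v u‖_v < 1` for all units `u`);
  p414009's analytic statement is the instance `Real.analyticLogv_ne_coe_unit`; conversely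
  `Real.nonarchIterImage_two_nonempty_of_exists_eq_coe_unit` (depth `2` is inhabited as soon as some `log_v u`
  IS a unit — the only way content can appear at depth `≥ 2`);
* packet level: `Real.tprodImages_honestU_add_two_arch_eq_empty_of_isReal`,
  `Column.unitImage_add_two_arch_eq_empty_of_isReal` — if `F` has a real place, the honest columns' unit images
  at `v_ℚ = ∞` are empty from depth `2` on (for every `logv`).

Honest framing: statements ABOUT THE MODEL (which typed (Ind3) containments are trivially true); nothing here
asserts or denies [IUTchIII] Cor. 3.12 or takes a side; typed ≠ proved; instantiated ≠ endorsed.  No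
definitions, no Prop-valued fact (D-0067 (1)).
-/

noncomputable section

open Set

namespace Summit.ABC.IUTFork.Thm311.Real

open NumberField IsDedekindDomain Literature.IUT.LogVolume Literature.IUT.LogThetaLattice
  Literature.NumberTheory.NumberFields

variable {F : Type} [Field F] [NumberField F]

/-! ## 1. Archimedean places: depths `0` and `1` are always inhabited -/

/-- `1` lies in the honest archimedean unit set `{‖a‖ = 1}` (depth `0`). [folklore] -/
theorem one_mem_archIterImage_zero (w : InfinitePlace F) :
    (1 : Carrier (.inl w : Place F)) ∈ archIterImage w 0 := by
  rw [archIterImage_zero]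
  exact norm_one

/-- `0 = log 1` lies in the depth-`1` archimedean image, at every archimedean place. [folklore] -/
theorem zero_mem_archIterImage_one (w : InfinitePlace F) :
    (0 : Carrier (.inl w : Place F)) ∈ archIterImage w 1 := by
  have h0 : InfinitePlace.Completion.extensionEmbedding w (0 : Carrier (.inl w : Place F)) = 0 := map_zero _
  have h1 : InfinitePlace.Completion.extensionEmbedding w (1 : Carrier (.inl w : Place F)) = 1 := map_one _
  exact ⟨1, one_mem_archIterImage_zero w, norm_one, by rw [h0, h1, Complex.log_one]⟩

/-! ## 2. Real places: the depth-`≥ 2` images are EMPTY -/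

/-- At a REAL place the embedding `K_w → ℂ` takes real values (Mathlib `extensionEmbeddingOfIsReal_apply`).
[folklore] -/
theorem im_extensionEmbedding_eq_zero_of_isReal {w : InfinitePlace F} (hw : w.IsReal)
    (x : Carrier (.inl w : Place F)) : (InfinitePlace.Completion.extensionEmbedding w x).im = 0 := by
  rw [← InfinitePlace.Completion.extensionEmbeddingOfIsReal_apply hw x, Complex.ofReal_im]

/-- At a real place a depth-`≥ 1` element embeds to `0` (real part `0` by `Re log z = log ‖z‖ = 0`,
imaginary part `0` by reality) — so it is `0`, never of norm one. [folklore] -/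
theorem eq_zero_of_mem_archIterImage_succ_of_isReal {w : InfinitePlace F} (hw : w.IsReal) (k : ℕ)
    {a : Carrier (.inl w : Place F)} (ha : a ∈ archIterImage w (k + 1)) : a = 0 := by
  have hre := re_extensionEmbedding_eq_zero_of_mem_archIterImage_succ w k ha
  have him := im_extensionEmbedding_eq_zero_of_isReal hw a
  have h0 : InfinitePlace.Completion.extensionEmbedding w a = 0 := Complex.ext hre him
  have h0' : InfinitePlace.Completion.extensionEmbedding w (0 : Carrier (.inl w : Place F)) = 0 := map_zero _
  exact (InfinitePlace.Completion.extensionEmbedding w).injective (by rw [h0, h0'])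

/-- **At a REAL place the honest archimedean iterate images of depth `≥ 2` are EMPTY** (for every `logv`):
the next iterate needs a depth-`(k+1)` element of norm `1`, but those are all `0`.
[claim: Mochizuki2012, status: disputed] -/
theorem archIterImage_add_two_eq_empty_of_isReal {w : InfinitePlace F} (hw : w.IsReal) (k : ℕ) :
    archIterImage w (k + 2) = ∅ := by
  ext a
  simp only [mem_empty_iff_false, iff_false]
  rintro ⟨b, hb1, hb, -⟩
  rw [eq_zero_of_mem_archIterImage_succ_of_isReal hw k hb1, norm_zero] at hb
  exact zero_ne_one hb

/-- The same for every depth `m′ ≥ 2`. [claim: Mochizuki2012, status: disputed] -/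
theorem archIterImage_eq_empty_of_isReal_of_two_le {w : InfinitePlace F} (hw : w.IsReal) {m' : ℕ}
    (hm' : 2 ≤ m') : archIterImage w m' = ∅ := by
  obtain ⟨k, rfl⟩ := Nat.exists_eq_add_of_le' hm'
  exact archIterImage_add_two_eq_empty_of_isReal hw k

/-- **Census at a real place**: the honest archimedean iterate image is empty EXACTLY from depth `2` on.
[claim: Mochizuki2012, status: disputed] -/
theorem archIterImage_eq_empty_iff_of_isReal {w : InfinitePlace F} (hw : w.IsReal) (m' : ℕ) :
    archIterImage w m' = ∅ ↔ 2 ≤ m' := by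
  refine ⟨fun h => ?_, archIterImage_eq_empty_of_isReal_of_two_le hw⟩
  by_contra hlt
  interval_cases m'
  · exact (eq_empty_iff_forall_notMem.mp h) 1 (one_mem_archIterImage_zero w)
  · exact (eq_empty_iff_forall_notMem.mp h) 0 (zero_mem_archIterImage_one w)

/-! ## 3. Complex places: depth `2` is inhabited, so the threshold `3` of `archIterImage_add_three_eq_empty` is sharp -/

/-- **At a COMPLEX place the depth-`2` archimedean image is INHABITED**: it contains the preimage of
`log i = iπ/2`, since `i = log(exp i)` lies in the depth-`1` image and `‖exp i‖ = ‖i‖ = 1` (Mathlib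
`surjective_extensionEmbedding_of_isComplex`).  Lemma and proof due to abc-iut-w5-d230 (independent replication
of p414009, STATUS 2026-08-26T00:31:44Z), folded here at their offer. [claim: Mochizuki2012, status: disputed] -/
theorem archIterImage_two_nonempty_of_isComplex {w : InfinitePlace F} (hw : w.IsComplex) :
    (archIterImage w 2).Nonempty := by
  have hsurj := InfinitePlace.Completion.surjective_extensionEmbedding_of_isComplex hw
  have hiso := InfinitePlace.Completion.isometry_extensionEmbedding w
  obtain ⟨c, hc⟩ := hsurj (Complex.exp Complex.I)
  obtain ⟨b, hb⟩ := hsurj Complex.I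
  obtain ⟨a, ha⟩ := hsurj (Complex.log Complex.I)
  have hc1 : ‖c‖ = 1 := by
    rw [← hiso.norm_map_of_map_zero (map_zero _) c, hc, Complex.norm_exp, Complex.I_re, Real.exp_zero]
  have hb1 : ‖b‖ = 1 := by
    rw [← hiso.norm_map_of_map_zero (map_zero _) b, hb, Complex.norm_I]
  have hlog : Complex.log (Complex.exp Complex.I) = Complex.I :=
    Complex.log_exp (by rw [Complex.I_im]; linarith [Real.pi_gt_three])
      (by rw [Complex.I_im]; linarith [Real.pi_gt_three])
  refine ⟨a, b, ⟨c, ?_, hc1, by rw [hb, hc, hlog]⟩, hb1, by rw [ha, hb]⟩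
  rw [archIterImage_zero]
  exact hc1

/-- **Census at a complex place**: the honest archimedean iterate image is empty EXACTLY from depth `3` on.
[claim: Mochizuki2012, status: disputed] -/
theorem archIterImage_eq_empty_iff_of_isComplex {w : InfinitePlace F} (hw : w.IsComplex) (m' : ℕ) :
    archIterImage w m' = ∅ ↔ 3 ≤ m' := by
  refine ⟨fun h => ?_, archIterImage_eq_empty_of_three_le w⟩
  by_contra hlt
  interval_cases m'
  · exact (eq_empty_iff_forall_notMem.mp h) 1 (one_mem_archIterImage_zero w)
  · exact (eq_empty_iff_forall_notMem.mp h) 0 (zero_mem_archIterImage_one w)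
  · exact (nonempty_iff_ne_empty.mp (archIterImage_two_nonempty_of_isComplex hw)) h

/-! ## 4. Nonarchimedean places: the binder-level criterion and its boundary -/

/-- **Binder-level criterion** (abc-iut-w5-d230's formulation, folded): for ANY family `logv`, if no value
`log_v u` on a unit is (the image in `K_v` of) a unit of `O_v`, then the depth-`≥ 2` honest iterate images are
EMPTY — the second iterate of the log-link has empty domain ([IUTchIII] Rmk. 1.1.1 (i)).  p414009's
`nonarchIterImage_add_two_eq_empty` is the instance `logv := analyticLogv F` at `e(v|p_v) ≤ p_v − 1`
(`analyticLogv_ne_coe_unit`). [claim: Mochizuki2012, status: disputed] -/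
theorem nonarchIterImage_add_two_eq_empty_of_forall_ne (logv : PadicLogs F) (v : HeightOneSpectrum (𝓞 F))
    (h : ∀ w u : (↥(integers v))ˣ,
      logv v (Additive.ofMul w) ≠ ((u : ↥(integers v)) : Carrier (.inr v : Place F))) (k : ℕ) :
    nonarchIterImage logv v (k + 2) = ∅ := by
  ext z
  simp only [mem_empty_iff_false, iff_false]
  rintro ⟨u, hu, -⟩
  obtain ⟨w, hw⟩ := nonarchIterImage_succ_subset_range logv v k hu
  exact h w u hw

/-- The criterion in NORM form: `‖log_v u‖_v < 1` for every unit `u` (e.g. `log_v(O_v^×) ⊆ 𝔪_v`) suffices,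
units having norm `1` (`norm_coe_unit_adicCompletionIntegers`). [claim: Mochizuki2012, status: disputed] -/
theorem nonarchIterImage_add_two_eq_empty_of_norm_lt_one (logv : PadicLogs F) (v : HeightOneSpectrum (𝓞 F))
    (h : ∀ w : (↥(integers v))ˣ, ‖logv v (Additive.ofMul w)‖ < 1) (k : ℕ) :
    nonarchIterImage logv v (k + 2) = ∅ := by
  refine nonarchIterImage_add_two_eq_empty_of_forall_ne logv v (fun w u hwu => ?_) k
  have h1 := h w
  have h2 : ‖((u : ↥(integers v)) : Carrier (.inr v : Place F))‖ = 1 :=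
    norm_coe_unit_adicCompletionIntegers F v u
  rw [hwu, h2] at h1
  exact lt_irrefl _ h1

/-- … for every depth `m′ ≥ 2`. [claim: Mochizuki2012, status: disputed] -/
theorem nonarchIterImage_eq_empty_of_two_le_of_norm_lt_one (logv : PadicLogs F) (v : HeightOneSpectrum (𝓞 F))
    (h : ∀ w : (↥(integers v))ˣ, ‖logv v (Additive.ofMul w)‖ < 1) {m' : ℕ} (hm' : 2 ≤ m') :
    nonarchIterImage logv v m' = ∅ := by
  obtain ⟨k, rfl⟩ := Nat.exists_eq_add_of_le' hm'
  exact nonarchIterImage_add_two_eq_empty_of_norm_lt_one logv v h k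

/-- **Boundary of the criterion**: the depth-`2` image is INHABITED as soon as SOME `log_v w` IS a unit `u` of
`O_v` (then `log_v u` lies in it) — the only way (Ind3) content can appear at depth `≥ 2` (abc-iut-w5-d230's
observation, folded). [claim: Mochizuki2012, status: disputed] -/
theorem nonarchIterImage_two_nonempty_of_exists_eq_coe_unit (logv : PadicLogs F) (v : HeightOneSpectrum (𝓞 F))
    (h : ∃ w u : (↥(integers v))ˣ,
      logv v (Additive.ofMul w) = ((u : ↥(integers v)) : Carrier (.inr v : Place F))) :
    (nonarchIterImage logv v 2).Nonempty := by
  obtain ⟨w, u, hwu⟩ := h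
  refine ⟨logv v (Additive.ofMul u), u, ?_, rfl⟩
  show ((u : ↥(integers v)) : Carrier (.inr v : Place F)) ∈ nonarchIterImage logv v 1
  rw [nonarchIterImage_one_eq_range]
  exact ⟨w, hwu⟩

/-! Depth `1` is always inhabited (`0 = log_v 1`: `zero_mem_nonarchIterImage_one`, and abc-iut-w4-d087's
`Real.nonarchIterImage_one_nonempty` in `Thm311PartIILattice`), so the nonarchimedean threshold `2` is sharp. -/

/-! ## 5. Packet level at `v_ℚ = ∞` when `F` has a real place -/

/-- If `F` has a REAL place `w`, the pure-tensor unit images of the honest components at `v_ℚ = ∞` are EMPTY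
from depth `2` on, for every family `logv` (the component at `w` is empty). [claim: Mochizuki2012, status: disputed] -/
theorem tprodImages_honestU_add_two_arch_eq_empty_of_isReal (X : PilotData F) (logv : PadicLogs F) (m : ℤ)
    (k : ℕ) (j : (thetaIndex X).Label) {w : InfinitePlace F} (hw : w.IsReal) :
    (logShellsDH X logv).tprodImages j (Sum.inl ()) (honestU X logv m (k + 2) (Sum.inl ())) = ∅ :=
  LogShells.tprodImages_eq_empty_of_eq_empty _ j _ _ ⟨.inl w, rfl⟩
    (archIterImage_add_two_eq_empty_of_isReal hw k)

/-- **Vacuity from depth `2` at `v_ℚ = ∞` for number fields with a real place**, for ANY column with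
abc-iut-w4-d029's `hunit` and ANY `logv`. [claim: Mochizuki2012, status: disputed] -/
theorem _root_.Summit.ABC.IUTFork.Thm311.Column.unitImage_add_two_arch_eq_empty_of_isReal
    (X : PilotData F) (logv : PadicLogs F) (C : Column (logShellsDH X logv))
    (hunit : ∀ (m : ℤ) (m' : ℕ) (j : (thetaIndex X).Label) (vQ : (thetaIndex X).VQ),
      C.unitImage m m' j vQ = (logShellsDH X logv).tprodImages j vQ (honestU X logv m m' vQ))
    (m : ℤ) (k : ℕ) (j : (thetaIndex X).Label) {w : InfinitePlace F} (hw : w.IsReal) :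
    C.unitImage m (k + 2) j (Sum.inl ()) = ∅ := by
  rw [hunit]
  exact tprodImages_honestU_add_two_arch_eq_empty_of_isReal X logv m k j hw

end Summit.ABC.IUTFork.Thm311.Real

end
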